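import Mathlib
import Literature.NumberTheory.EllipticCurves.CanonicalPAdicHeightParallelogramProofs
import Literature.NumberTheory.EllipticCurves.IsogenyMordellWeilRankProofs
import HarnessLib

/-!
# IsogenyNonsingularReduction

Topic `Literature/NumberTheory/EllipticCurves`. Named literature fact(s) relocated by the gate from `Summits/BirchSwinnertonDyer/BirchSwinnertonDyer/Theorems/SlopeDichotomyA2DegenerateLocusA2HeightIntegralityNeron.lean`
(accept-time relocation of `[cite]`d propositions written inline in a Summits proposal; human ruling 2026-08-15).
Sources: DokchitserDokchitser2015LocalInvariants, SilvermanATAEC1994.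

* `Literature.NumberTheory.EllipticCurves.isogeny_pointHom_maps_nonsingularReductionSubgroupAt`
-/

namespace Literature.NumberTheory.EllipticCurves

open scoped Classical MatrixGroups ModularForm
open PowerSeries CongruenceSubgroup WeierstrassCurve Literature.NumberTheory.EllipticCurves

/-- **Dokchitser–Dokchitser 2015, Lemma 24 (proof, first sentence); Silverman ATAEC IV.5.1, IV.9.1–9.2 — an
isogeny of prime degree maps points of non-singular reduction to points of non-singular reduction.** Printed
(`K` a finite extension of `ℚ_ℓ`, `φ : E → E'` an isogeny of prime degree `p` defined over `K` — the paper's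
standing hypothesis, §1 —, minimal models): «The isogeny `φ` induces maps
`E(K) → E'(K)` and `E₀(K) → E'₀(K)`, and so `E/E₀ → E'/E'₀`» — `φ` extends to the Néron models (Néron mapping
property, ATAEC IV.5.1), a homomorphism of smooth group schemes over `R` maps the identity component `𝓔⁰` into
`𝓔'⁰`, and `E₀(K) = 𝓔⁰(R)` for a minimal Weierstrass equation (ATAEC Cor. IV.9.1–9.2). Read on RATIONAL points,
for globally minimal `W, W'/ℚ` (minimal at every `ℓ`) and the map `f = φ(ℚ)` of a `ℚ`-isogeny on `E(ℚ)`
(`WeierstrassCurve.Isogeny.exists_pointHom`) of prime degree (`Isogeny.degree = #ker`, the degree in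
characteristic `0`): `f` maps `E(ℚ) ∩ E₀(ℚ_ℓ)` (the tree's
`WeierstrassCurve.nonsingularReductionSubgroupAt`) into `E'(ℚ) ∩ E'₀(ℚ_ℓ)` for every prime `ℓ`. Polymorphic in
the `DecidableEq ℚ` instance of the group law. Named fact (D-0014): nothing is asserted; users take
`(h : isogeny_pointHom_maps_nonsingularReductionSubgroupAt)`.
[cite: DokchitserDokchitser2015LocalInvariants, §6 «Tamagawa numbers», Lemma «c/c' is a power of p» (Lemma 24 of
arXiv:1208.5519), proof, first sentence: `E₀(K) → E'₀(K)`]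
[cite: SilvermanATAEC1994, IV.5.1 (Néron mapping property) and Cor. IV.9.1–9.2 (`E₀(K) = 𝓔⁰(R)`)]
[file NumberTheory/EllipticCurves/IsogenyNonsingularReduction] -/
def isogeny_pointHom_maps_nonsingularReductionSubgroupAt : Prop :=
  ∀ (W W' : WeierstrassCurve ℚ) [DecidableEq ℚ] [W.IsElliptic] [W'.IsElliptic] [W.IsGloballyMinimal]
    [W'.IsGloballyMinimal] (φ : WeierstrassCurve.Isogeny W W'), φ.degree.Prime →
    ∀ (f : W.toAffine.Point →+ W'.toAffine.Point),
      (∀ P : W.toAffine.Point, W'.toGeomPoints (f P) = φ (W.toGeomPoints P)) →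
    ∀ (ℓ : ℕ) [Fact ℓ.Prime], ∀ R ∈ W.nonsingularReductionSubgroupAt ℓ,
      f R ∈ W'.nonsingularReductionSubgroupAt ℓ

end Literature.NumberTheory.EllipticCurves
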